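import Literature.NumberTheory.GaloisCohomology.Howard2004.PropagateUnramifiedProofs
import Literature.NumberTheory.EllipticCurves.ZpExtensionEisensteinSelmerUnramifiedProofs
import Literature.NumberTheory.EllipticCurves.ZpExtensionScalarTwistFiniteProofs
import HarnessLib

/-!
# H.5(b) for Howard's `F_𝔮` at the finite places outside `S ∪ {v ∣ p}` (and their conjugates): the Eisenstein levels
# and the curve `E[p^k]` (theorems only; no definition, no named fact, no instance)

Topic `NumberTheory/EllipticCurves` (D1 road of cell `pub/bsd-print-x9`; companion of `ZpExtensionEisensteinSelmerStructure`
(Howard's `F_𝔮`, `eisensteinSelmerStructure_inr_of_not_mem`: the plain unramified condition off `S ∪ {v ∣ p}`),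
`ZpExtensionEisensteinSelmerUnramifiedProofs` (the twist `E[p^k] ⊗ A_{m,k}(ψ)` is unramified at the good places `v ∤ p`)
and `GaloisCohomology/Howard2004/PropagateUnramifiedProofs` (the `v`-clause of `Howard2004.H5b` at a place where the
Selmer structure is unramified on both sides)).

For the hypothesis `Howard2004.DVRSetting.SatisfiesH.h5b` («`F̄_𝔮` = `F_𝔮` propagated to `T̄ = E[p]` is `G_ℚ`-stable»,
Howard H.5(b), arXiv 1202.6340 p. 7 L96–97) of the typed Theorem 1.6.1, at level `k`, residual presentation
`π̄ : T_𝔮/p^k ↠ T̄` (any `IsQuotientBy`), action `θ` of `τ` on `T̄` (any `ResidualTau`), conjugation datum `cd`: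

* **`ZpExtension.eisensteinSelmerStructure_h5b_inr_of_not_mem`** — the `v`-clause of `H5b` for `F_𝔮` at a finite place
  `v` with `v, σv ∉ S` and `v, σv ∤ p`, the level-`k` twist finite and unramified at `v` and `σ v`, `φ_v` respecting
  inertia;
* **`WeierstrassCurve.eisensteinSelmerStructure_h5b_inr_of_not_mem`** — the same for `M_k = E[p^k]` with `S ⊇` the bad
  places away from `p` (unramifiedness by Néron–Ogg–Shafarevich, finiteness of `E[p^k]`), and `…_ofLifts` for the
  canonical datum `ConjugationDatum.ofLifts` (inertia compatibility discharged).

The clauses at `v ∣ p` (ordinary condition) and `v ∈ S` (saturated unramified tower) are NOT treated here.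
References: [Howard2004HeegnerKolyvagin] H.5(b) (arXiv p. 7, L96–97), Def. 1.1.3, Def. 2.1.10, Def. 3.1.2;
[MazurRubin2004] Lemma 1.1.5, Example 1.1.6; [SilvermanAEC2009] Prop. VII.4.1(a). BSD is not proved by any of this.
-/

noncomputable section

open scoped TensorProduct ContRepresentation
open Field IsDedekindDomain
open scoped NumberField

namespace Literature.NumberTheory.EllipticCurves.ZpExtension

open Literature.NumberTheory.GaloisRepresentations
open Literature.NumberTheory.GaloisRepresentations.DiscreteGaloisModule (SelmerStructure)
open Literature.NumberTheory.GaloisCohomology.Howard2004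

variable {K : Type} [Field K] [NumberField K] {p : ℕ} [hp : Fact p.Prime] (κ : ZpExtension K p)
  {M : ℕ → Type} [∀ k, AddCommGroup (M k)] [∀ k, TopologicalSpace (M k)] [∀ k, DiscreteTopology (M k)]
  (ρ : ∀ k, DiscreteGaloisModule K (M k))
  (t : ∀ k, (ρ (k + 1)).toContRepresentation →ⁱL (ρ k).toContRepresentation)
  {m : ℕ} (hm : 1 ≤ m)
  (S : Finset (HeightOneSpectrum (𝓞 K)))
  (Φ : ∀ v : HeightOneSpectrum (𝓞 K), ((p : ℕ) : 𝓞 K) ∈ v.asIdeal → OrdinaryFiltration ρ t v)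

/-- **The `v`-clause of H.5(b) for `F_𝔮` at a finite place off `S ∪ {v ∣ p}` together with its conjugate**: for any
residual presentation `π̄ : M_k ⊗ A_{m,k}(ψ) ↠ T̄` over a coefficient ring `R`, any action `θ` of `τ` on `T̄`, and a
conjugation datum whose `φ_v` respects inertia, if the level-`k` twist is finite and unramified at `v` and `σ v` then
`θ_* (transport_v (F̄_𝔮 (σ v))) = F̄_𝔮 v` (both are `H¹_ur(K_v, T̄)`).
[cite: Howard2004HeegnerKolyvagin, H.5(b) (arXiv p. 7, L96–97), Def. 2.1.10 and Def. 3.1.2] [cite: MazurRubin2004, Lemma 1.1.5 and Example 1.1.6] -/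
theorem eisensteinSelmerStructure_h5b_inr_of_not_mem (k : ℕ) [Finite (M k)]
    {R : Type} [CommRing R] [Module R (IwasawaAlgebra.EisensteinCoeff.Twisted p m k (M k))]
    {cd : ConjugationDatum K} {Nbar : Type} [AddCommGroup Nbar] [TopologicalSpace Nbar] [DiscreteTopology Nbar]
    [Module R Nbar] {ρbar : DiscreteGaloisModule K Nbar} {I : Ideal R}
    {πbar : IwasawaAlgebra.EisensteinCoeff.Twisted p m k (M k) →ₗ[R] Nbar}
    (h : IsQuotientBy (κ.eisensteinTwist (ρ k) hm k) I ρbar πbar) (A : ResidualTau (R := R) cd ρbar)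
    {v : HeightOneSpectrum (𝓞 K)} (hv : ((p : ℕ) : 𝓞 K) ∉ v.asIdeal) (hvS : v ∉ S)
    (hσv : ((p : ℕ) : 𝓞 K) ∉ (cd.σ • v).asIdeal) (hσvS : cd.σ • v ∉ S)
    (hur : GaloisRep.IsUnramifiedAt v (κ.eisensteinTwist (ρ k) hm k))
    (hurσ : GaloisRep.IsUnramifiedAt (cd.σ • v) (κ.eisensteinTwist (ρ k) hm k))
    (hI : ∀ g, g ∈ absInertia (v.adicCompletion K) ↔ cd.φ v g ∈ absInertia ((cd.σ • v).adicCompletion K)) :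
    ((h.propagateStructure (κ.eisensteinSelmerStructure ρ t hm S Φ k)) (Sum.inr (cd.σ • v))).map
        ((A.thetaH1 (Sum.inr v)).comp (cd.transportH1 ρbar v)) =
      (h.propagateStructure (κ.eisensteinSelmerStructure ρ t hm S Φ k)) (Sum.inr v) := by
  haveI := IwasawaAlgebra.EisensteinCoeff.finite_twisted (p := p) (k := k) (M := M k) hm
  exact h.map_thetaH1_comp_transportH1_propagateStructure_eq_of_unramified A _
    (κ.eisensteinSelmerStructure_inr_of_not_mem ρ t hm S Φ k hv hvS)
    (κ.eisensteinSelmerStructure_inr_of_not_mem ρ t hm S Φ k hσv hσvS) hur hurσ hI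

end Literature.NumberTheory.EllipticCurves.ZpExtension

namespace WeierstrassCurve

open Literature.NumberTheory.EllipticCurves Literature.NumberTheory.GaloisRepresentations
open Literature.NumberTheory.GaloisRepresentations.DiscreteGaloisModule (SelmerStructure)
open Literature.NumberTheory.GaloisCohomology.Howard2004

variable {K : Type} [Field K] [NumberField K] (W : WeierstrassCurve K) [W.IsElliptic] {p : ℕ} [hp : Fact p.Prime]
  (κ : ZpExtension K p) {m : ℕ} (hm : 1 ≤ m)
  (t : ∀ k, (W.torsionGaloisModule ((p : ℤ) ^ (k + 1))).toContRepresentation →ⁱL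
    (W.torsionGaloisModule ((p : ℤ) ^ k)).toContRepresentation)
  (S : Finset (HeightOneSpectrum (𝓞 K)))
  (Φ : ∀ v : HeightOneSpectrum (𝓞 K), ((p : ℕ) : 𝓞 K) ∈ v.asIdeal →
    ZpExtension.OrdinaryFiltration (fun k ↦ W.torsionGaloisModule ((p : ℤ) ^ k)) t v)

/-- **H.5(b) for `F_𝔮` ON THE CURVE at a finite place off `S ∪ {v ∣ p}` and its conjugate** (`S` containing the bad
places away from `p`): the `v`-clause of `Howard2004.H5b` for any residual presentation of `E[p^k] ⊗ A_{m,k}(ψ)`, any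
`θ`, and any conjugation datum whose `φ_v` respects inertia.
[cite: Howard2004HeegnerKolyvagin, H.5(b) (arXiv p. 7, L96–97), Def. 2.1.10 and Def. 3.1.2] [cite: SilvermanAEC2009, Prop. VII.4.1(a)] -/
theorem eisensteinSelmerStructure_h5b_inr_of_not_mem
    (hbad : ∀ v : HeightOneSpectrum (𝓞 K), v ∉ S → ((p : ℕ) : 𝓞 K) ∉ v.asIdeal → W.HasGoodReductionAt v) (k : ℕ)
    {R : Type} [CommRing R]
    [Module R (IwasawaAlgebra.EisensteinCoeff.Twisted p m k (geomTorsion W ((p : ℤ) ^ k)))]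
    {cd : ConjugationDatum K} {Nbar : Type} [AddCommGroup Nbar] [TopologicalSpace Nbar] [DiscreteTopology Nbar]
    [Module R Nbar] {ρbar : DiscreteGaloisModule K Nbar} {I : Ideal R}
    {πbar : IwasawaAlgebra.EisensteinCoeff.Twisted p m k (geomTorsion W ((p : ℤ) ^ k)) →ₗ[R] Nbar}
    (h : IsQuotientBy (κ.eisensteinTwist (W.torsionGaloisModule ((p : ℤ) ^ k)) hm k) I ρbar πbar)
    (A : ResidualTau (R := R) cd ρbar)
    {v : HeightOneSpectrum (𝓞 K)} (hv : ((p : ℕ) : 𝓞 K) ∉ v.asIdeal) (hvS : v ∉ S)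
    (hσv : ((p : ℕ) : 𝓞 K) ∉ (cd.σ • v).asIdeal) (hσvS : cd.σ • v ∉ S)
    (hI : ∀ g, g ∈ absInertia (v.adicCompletion K) ↔ cd.φ v g ∈ absInertia ((cd.σ • v).adicCompletion K)) :
    ((h.propagateStructure (κ.eisensteinSelmerStructure (fun k ↦ W.torsionGaloisModule ((p : ℤ) ^ k)) t hm S Φ k))
        (Sum.inr (cd.σ • v))).map ((A.thetaH1 (Sum.inr v)).comp (cd.transportH1 ρbar v)) =
      (h.propagateStructure (κ.eisensteinSelmerStructure (fun k ↦ W.torsionGaloisModule ((p : ℤ) ^ k)) t hm S Φ k))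
        (Sum.inr v) := by
  haveI : Finite (geomTorsion W ((p : ℤ) ^ k)) :=
    finite_torsionPoints_holds W (AlgebraicClosure K) (pow_ne_zero _ (Int.natCast_ne_zero.2 hp.out.ne_zero))
  exact κ.eisensteinSelmerStructure_h5b_inr_of_not_mem (fun k ↦ W.torsionGaloisModule ((p : ℤ) ^ k)) t hm S Φ k h A
    hv hvS hσv hσvS (W.isUnramifiedAt_eisensteinTwist_torsionGaloisModule_of_not_mem κ hm hbad hvS hv k)
    (W.isUnramifiedAt_eisensteinTwist_torsionGaloisModule_of_not_mem κ hm hbad hσvS hσv k) hI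

/-- The same for the CANONICAL conjugation datum `ConjugationDatum.ofLifts` (inertia compatibility of its `φ_v`
discharged by `phi_mem_absInertia_iff`). [cite: Howard2004HeegnerKolyvagin, H.5(b) (arXiv p. 7, L96–97), Def. 2.1.10 and Def. 3.1.2]
[cite: SilvermanAEC2009, Prop. VII.4.1(a)] -/
theorem eisensteinSelmerStructure_h5b_inr_of_not_mem_ofLifts
    (hbad : ∀ v : HeightOneSpectrum (𝓞 K), v ∉ S → ((p : ℕ) : 𝓞 K) ∉ v.asIdeal → W.HasGoodReductionAt v) (k : ℕ)
    {R : Type} [CommRing R]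
    [Module R (IwasawaAlgebra.EisensteinCoeff.Twisted p m k (geomTorsion W ((p : ℤ) ^ k)))]
    (σ : K ≃ₐ[ℚ] K) (hσ₁ : σ ≠ 1) (hσ : σ * σ = 1) (τ : AlgebraicClosure K ≃+* AlgebraicClosure K)
    (hτ : IsLiftOfAut σ τ) (hτ₂ : Function.Involutive τ)
    {Nbar : Type} [AddCommGroup Nbar] [TopologicalSpace Nbar] [DiscreteTopology Nbar]
    [Module R Nbar] {ρbar : DiscreteGaloisModule K Nbar} {I : Ideal R}
    {πbar : IwasawaAlgebra.EisensteinCoeff.Twisted p m k (geomTorsion W ((p : ℤ) ^ k)) →ₗ[R] Nbar}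
    (h : IsQuotientBy (κ.eisensteinTwist (W.torsionGaloisModule ((p : ℤ) ^ k)) hm k) I ρbar πbar)
    (A : ResidualTau (R := R) (ConjugationDatum.ofLifts σ hσ₁ hσ τ hτ hτ₂) ρbar)
    {v : HeightOneSpectrum (𝓞 K)} (hv : ((p : ℕ) : 𝓞 K) ∉ v.asIdeal) (hvS : v ∉ S)
    (hσv : ((p : ℕ) : 𝓞 K) ∉ (σ • v).asIdeal) (hσvS : σ • v ∉ S) :
    ((h.propagateStructure (κ.eisensteinSelmerStructure (fun k ↦ W.torsionGaloisModule ((p : ℤ) ^ k)) t hm S Φ k))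
        (Sum.inr (σ • v))).map
        ((A.thetaH1 (Sum.inr v)).comp ((ConjugationDatum.ofLifts σ hσ₁ hσ τ hτ hτ₂).transportH1 ρbar v)) =
      (h.propagateStructure (κ.eisensteinSelmerStructure (fun k ↦ W.torsionGaloisModule ((p : ℤ) ^ k)) t hm S Φ k))
        (Sum.inr v) :=
  W.eisensteinSelmerStructure_h5b_inr_of_not_mem κ hm t S Φ hbad k h A hv hvS hσv hσvS
    (ConjugationDatum.phi_mem_absInertia_iff hσ v)

end WeierstrassCurve

end
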